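import Mathlib.Analysis.Calculus.FDeriv.Symmetric
import Literature.NumberTheory.Automorphic.ArchimedeanCalculusProofs
import Literature.NumberTheory.Automorphic.ArchimedeanEnvelopingAction
import HarnessLib

/-!
# The archimedean calculus for a general linear real group: `U(𝔤)` acts on smooth functions
(discharge of the named fact `applyFree_congr` of `ArchimedeanCalculus`)

Topic `NumberTheory/Automorphic`. Let `H : RealMatrixGroup A N` be *any* linear real group over a
finite-dimensional coefficient algebra `A` (`𝔤 = H.lie` an `Ad H`-stable real Lie subalgebra of
`𝔤𝔩(N, A)` with `exp (tX) ∈ H` for `X ∈ 𝔤`; `𝔤` need not be all of `Lie(H)`), `ι : H → G` a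
homomorphism into a group, and `φ : G → ℂ` smooth in the archimedean variable
(`IsArchSmooth ι φ`: `Y ↦ φ (g ι(exp Y))` is `C^∞` on `𝔤` for every `g`). Borel–Jacquet (1979),
§1.5: `𝔤` acts on such functions by `(X φ)(g) = d/dt φ (g exp tX)|_{t=0}` and this extends to an
action of `U(𝔤)` (for `GL_n(ℝ)`: Goldfeld (2006), Def. 2.2.1 and Prop. 2.2.3,
`D_α ∘ D_β - D_β ∘ D_α = D_{[α, β]}`, "the ring of these differential operators is a realization
of the universal enveloping algebra"). The tree proved this for the *full* linear group only
(`H.lie = ⊤ = H.carrier`: `ArchimedeanLieBracket.lieDeriv_bracket_of_top`,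
`ArchimedeanEnvelopingAction.applyFree_congr_of_top`) and, for general `H`, that `X φ` is again
smooth (`ArchimedeanCalculusProofs.isArchSmooth_lieDeriv_of_isArchSmooth`). This file PROVES the
rest for every `H`:

* `RealMatrixGroup.eventually_localLog_mem_lie` — **the exponential chart of `𝔤` re-centred**: for
  `Y₀, X ∈ 𝔤` and `(Y, t) → (Y₀, 0)` with `Y ∈ 𝔤`, `log (exp(-Y₀) exp(Y) exp(tX)) ∈ 𝔤` (`log` the
  local logarithm `Literature.Analysis.Calculus.localLog`), by the path
  `s ↦ exp(-sY₀) exp(sY) exp(stX)` from `1`, whose logarithmic derivative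
  `Ad(e^{-stX})(Ad(e^{-sY})(-Y₀) + Y) + tX` lies in `𝔤`, and
  `Literature.Analysis.Calculus.exists_isOpen_forall_localLog_mem` (paths with logarithmic
  derivative in `𝔤` have logarithm in `𝔤`; no Baker–Campbell–Hausdorff series). The same argument
  is inlined in `ArchimedeanCalculusProofs`; here it is a reusable statement, with the auxiliary
  `RealMatrixGroup.exp_mul_mul_exp_neg_mem_lie`, `.exists_retraction_lie`, `.closedComplemented_lie`;
* `lieDeriv_bracket` — **`[X, Y] φ = X (Y φ) - Y (X φ)`** for smooth `φ` and `X, Y ∈ 𝔤`: with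
  `F(M) = φ (g ι(exp (log M)))` near `M = 1` one has `F (exp sX exp tZ) = φ (g ι(exp sX) ι(exp tZ))`
  for small `s, t` (chart lemma at `Y₀ = 0`), hence `(Z φ)(g ι(exp sX)) = DF(exp sX)(exp(sX) Z)`
  and `(X (Y φ))(g) = D²F(1)(X, Y) + DF(1)(XY)`; the symmetric second derivative cancels in the
  antisymmetrisation (Goldfeld's proof of Prop. 2.2.3, read in the exponential chart);
* `exists_lieHom_lieDeriv` — `X ↦ (ψ ↦ X ψ)` is a morphism of real Lie algebras
  `𝔤 →ₗ⁅ℝ⁆ End_ℂ (archSmooth ι)` (packaged as an existence statement, so that this file has no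
  definitions; the `⊤` case keeps its definition `lieDerivRep`);
  `coe_envelopingAction_freeToEnveloping_of_forall_eq` — for such a `ρ`, the word action
  `applyFree ι p ψ` of `p ∈ ℝ⟨𝔤⟩` is the action of the image of `p` in `U(𝔤)` under
  `envelopingAction ρ` (both sides are `ℝ`-linear in `p` and agree on the word basis);
* `applyFree_congr_holds` — **the named fact `applyFree_congr`**: if `p, q ∈ ℝ⟨𝔤⟩` have the same
  image in `U(𝔤)` then `p φ = q φ` for smooth `φ`; consequences `isArchSmooth_applyFree_of_isArchSmooth`,
  `applyFree_ι_mul_of_isArchSmooth` (`(X · p) φ = X (p φ)`),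
  `applyFree_lieDeriv_of_isCentralWord_of_isArchSmooth` (`z (X φ) = X (z φ)` for central `z`).

Everything here is proved; there are no definitions.

## References

* A. Borel, H. Jacquet, *Automorphic forms and automorphic representations*, Proc. Sympos. Pure
  Math. 33 (1979), part 1, §1.5–1.6 [BorelJacquet1979].
* D. Goldfeld, *Automorphic Forms and L-Functions for the Group GL(n, ℝ)* (2006), §2.2,
  Def. 2.2.1, Prop. 2.2.3 (held; PDF pp. 41–42) [Goldfeld2006].
* A. W. Knapp, *Lie Groups Beyond an Introduction* (2002), 0.§2–§3, I.§10 (Prop. 1.89), III.§1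
  [Knapp2002].
* N. R. Wallach, *Real Reductive Groups I* (1988), §1.6 [WallachRRG1].
* J. Dixmier, *Enveloping Algebras* (1977/1996), 2.1.1.
-/

-- Mathlib idiom (Mathlib/Algebra/Lie/OfAssociative.lean); needed to mention Lie subalgebras of matrix algebras
attribute [local instance 100] LieRing.ofAssociativeRing

noncomputable section

open scoped MatrixGroups Matrix ContDiff Topology
open Filter Set
open Literature.Analysis.Calculus

namespace Literature.NumberTheory.Automorphic

section General

variable {A : Type*} [NormedCommRing A] [NormedAlgebra ℝ A] [NormedAlgebra ℚ A] [CompleteSpace A]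
  [StarRing A] {N : Type*} [Fintype N] [DecidableEq N] {H : RealMatrixGroup A N}
  {G : Type*} [Group G] (ι : H.carrier →* G)

/-! ### The Lie algebra of a linear real group in the Banach algebra `𝔤𝔩(N, A)` -/

variable (H) in
/-- `𝔤 = H.lie` is `Ad (exp 𝔤)`-stable: `exp(c) Z exp(-c) ∈ 𝔤` for `c, Z ∈ 𝔤` (`exp c ∈ H` and `𝔤`
is `Ad H`-stable). Knapp 2002, I.§10, Prop. 1.89. [folklore] -/
theorem RealMatrixGroup.exp_mul_mul_exp_neg_mem_lie :
    ∀ c ∈ H.lie.toSubmodule, ∀ Z ∈ H.lie.toSubmodule,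
      NormedSpace.exp c * Z * NormedSpace.exp (-c) ∈ H.lie.toSubmodule := by
  intro c hc Z hZ
  have h := H.conj_mem_lie (expGL c) (by simpa using H.expGL_smul_mem c hc 1) Z hZ
  rwa [← expGL_neg, coe_expGL, coe_expGL] at h

variable (H) in
/-- A linear retraction `𝔤𝔩(N, A) → 𝔤` onto the Lie algebra. [folklore] -/
theorem RealMatrixGroup.exists_retraction_lie :
    ∃ π : Matrix N N A →ₗ[ℝ] H.lie.toSubmodule, ∀ Y : H.lie.toSubmodule, π Y = Y := by
  obtain ⟨π, hπ⟩ := H.lie.toSubmodule.subtype.exists_leftInverse_of_injective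
    H.lie.toSubmodule.ker_subtype
  exact ⟨π, fun Y => LinearMap.congr_fun hπ Y⟩

variable (H) in
set_option backward.isDefEq.respectTransparency false in
open scoped Matrix.Norms.Operator in
/-- `𝔤 = H.lie` is a complemented closed subspace of the Banach algebra `𝔤𝔩(N, A)` when `A` is
finite-dimensional (every linear retraction is continuous). [folklore] -/
theorem RealMatrixGroup.closedComplemented_lie [FiniteDimensional ℝ A] :
    H.lie.toSubmodule.ClosedComplemented := by
  obtain ⟨π, hπ⟩ := H.exists_retraction_lie
  exact ⟨⟨π, π.continuous_of_finiteDimensional⟩, hπ⟩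

variable (H) in
-- As in `Mathlib/Analysis/Normed/Algebra/MatrixExponential.lean` and `ArchimedeanLieBracket`: the
-- scoped `L∞`-operator normed ring structure on matrices is only reducibly-defeq to the Pi
-- uniformity, so `CompleteSpace (Matrix N N A)` and the analytic facts about `exp` need this setting.
set_option backward.isDefEq.respectTransparency false in
open scoped Matrix.Norms.Operator in
/-- **The exponential chart of `𝔤` re-centred at `exp Y₀`.** For `Y₀, X ∈ 𝔤 = H.lie` (`A`
finite-dimensional) and `(Y, t)` near `(Y₀, 0)` with `Y ∈ 𝔤`,
`log (exp(-Y₀) · exp(Y) · exp(tX)) ∈ 𝔤`, where `log = localLog` is the local inverse of the matrix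
exponential at `0`: the path `γ(s) = exp(-sY₀) exp(sY) exp(stX)` from `1` to this product has
logarithmic derivative `γ⁻¹γ' = Ad(e^{-stX})(Ad(e^{-sY})(-Y₀) + Y) + tX ∈ 𝔤`, and paths with
logarithmic derivative in `𝔤` near `1` have logarithm in `𝔤`
(`Literature.Analysis.Calculus.exists_isOpen_forall_localLog_mem`). This is the local form of
"the subgroup generated by `exp 𝔤` is a Lie subgroup with Lie algebra `𝔤`, charted by `exp`".
Knapp 2002, 0.§2–§3 and I.§10; Hall 2015, Thm. 5.20; Hilgert–Neeb 2012, §9.3–9.4. [folklore] -/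
theorem RealMatrixGroup.eventually_localLog_mem_lie [FiniteDimensional ℝ A] {Y₀ X : Matrix N N A}
    (hY₀ : Y₀ ∈ H.lie.toSubmodule) (hX : X ∈ H.lie.toSubmodule) :
    ∀ᶠ p : Matrix N N A × ℝ in 𝓝 (Y₀, 0), p.1 ∈ H.lie.toSubmodule →
      localLog (NormedSpace.exp (-Y₀) * NormedSpace.exp p.1 * NormedSpace.exp (p.2 • X)) ∈
        H.lie.toSubmodule := by
  have hAd := H.exp_mul_mul_exp_neg_mem_lie
  obtain ⟨V, hVo, h1V, -, hpath⟩ :=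
    exists_isOpen_forall_localLog_mem H.closedComplemented_lie hAd
  -- the paths `γ_p (s) = exp (s(-Y₀)) exp (s p.1) exp (s p.2 X)`, jointly continuous in `(p, s)`
  set Γ : (Matrix N N A × ℝ) × ℝ → Matrix N N A := fun q =>
    NormedSpace.exp (q.2 • (-Y₀)) * NormedSpace.exp (q.2 • q.1.1) *
      NormedSpace.exp (q.2 • (q.1.2 • X)) with hΓ
  have hΓc : Continuous Γ :=
    ((NormedSpace.exp_continuous.comp (continuous_snd.smul continuous_const)).mul
      (NormedSpace.exp_continuous.comp (continuous_snd.smul (continuous_fst.comp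
        continuous_fst)))).mul
      (NormedSpace.exp_continuous.comp (continuous_snd.smul ((continuous_snd.comp
        continuous_fst).smul continuous_const)))
  have hΓ0 : ∀ s : ℝ, Γ ((Y₀, 0), s) = 1 := fun s => by
    simp only [hΓ, zero_smul, smul_zero, NormedSpace.exp_zero, mul_one, smul_neg]
    exact exp_neg_mul_exp (s • Y₀)
  -- for `p` near `(Y₀, 0)` the whole path lies in `V`
  have hev : ∀ᶠ p : Matrix N N A × ℝ in 𝓝 (Y₀, 0), ∀ s ∈ Icc (0 : ℝ) 1, Γ (p, s) ∈ V := by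
    apply isCompact_Icc.eventually_forall_of_forall_eventually
    intro s _
    exact hΓc.continuousAt.preimage_mem_nhds (by rw [hΓ0]; exact hVo.mem_nhds h1V)
  filter_upwards [hev] with p hp hp1
  have hWmem : p.2 • X ∈ H.lie.toSubmodule := H.lie.toSubmodule.smul_mem p.2 hX
  -- the logarithmic derivative of `γ_p`
  set ξ : ℝ → Matrix N N A := fun s =>
    NormedSpace.exp (-(s • (p.2 • X))) * (NormedSpace.exp (-(s • p.1)) * (-Y₀) *
      NormedSpace.exp (s • p.1) + p.1) * NormedSpace.exp (s • (p.2 • X)) + p.2 • X with hξ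
  have hξmem : ∀ s : ℝ, ξ s ∈ H.lie.toSubmodule := by
    intro s
    refine H.lie.toSubmodule.add_mem ?_ hWmem
    have h1 : NormedSpace.exp (-(s • p.1)) * (-Y₀) * NormedSpace.exp (s • p.1) ∈
        H.lie.toSubmodule := by
      have := hAd (-(s • p.1)) (H.lie.toSubmodule.neg_mem (H.lie.toSubmodule.smul_mem s hp1))
        (-Y₀) (H.lie.toSubmodule.neg_mem hY₀)
      rwa [neg_neg] at this
    have h2 := H.lie.toSubmodule.add_mem h1 hp1
    have := hAd (-(s • (p.2 • X))) (H.lie.toSubmodule.neg_mem (H.lie.toSubmodule.smul_mem s hWmem))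
      _ h2
    rwa [neg_neg] at this
  have hξc : Continuous ξ := by
    have he : ∀ Z : Matrix N N A, Continuous fun s : ℝ => NormedSpace.exp (s • Z) := fun Z =>
      NormedSpace.exp_continuous.comp (continuous_id.smul continuous_const)
    have he' : ∀ Z : Matrix N N A, Continuous fun s : ℝ => NormedSpace.exp (-(s • Z)) := fun Z =>
      NormedSpace.exp_continuous.comp (continuous_id.smul continuous_const).neg
    exact (((he' _).mul ((((he' _).mul continuous_const).mul (he _)).add continuous_const)).mul
      (he _)).add continuous_const
  obtain ⟨B, hB⟩ := isCompact_Icc.exists_bound_of_continuousOn (s := Icc (0 : ℝ) 1) hξc.continuousOn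
  -- the derivative of `γ_p`
  have hderiv : ∀ s : ℝ, HasDerivAt (fun r => Γ (p, r)) (Γ (p, s) * ξ s) s := by
    intro s
    have ha := hasDerivAt_exp_smul_const (𝕂 := ℝ) (-Y₀) s
    have hb := hasDerivAt_exp_smul_const (𝕂 := ℝ) p.1 s
    have hc := hasDerivAt_exp_smul_const (𝕂 := ℝ) (p.2 • X) s
    have h := (ha.mul hb).mul hc
    refine (h.congr_of_eventuallyEq (Eventually.of_forall fun r => rfl)).congr_deriv ?_
    have hcW : ∀ Z : Matrix N N A,
        NormedSpace.exp (s • (p.2 • X)) * (NormedSpace.exp (-(s • (p.2 • X))) * Z) = Z :=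
      fun Z => by rw [← mul_assoc, exp_mul_exp_neg, one_mul]
    have hbY : ∀ Z : Matrix N N A,
        NormedSpace.exp (s • p.1) * (NormedSpace.exp (-(s • p.1)) * Z) = Z :=
      fun Z => by rw [← mul_assoc, exp_mul_exp_neg, one_mul]
    simp only [hΓ, hξ, Pi.mul_apply, mul_add, add_mul, mul_assoc, hcW, hbY]
  have h := hpath (fun s => Γ (p, s)) ξ B (by simp [hΓ]) hp (fun s _ => hderiv s)
    (fun s _ => hξmem s) hB 1 (right_mem_Icc.2 zero_le_one)
  simpa [hΓ] using h

/-! ### The bracket relation -/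

set_option backward.isDefEq.respectTransparency false in
open scoped Matrix.Norms.Operator in
/-- **The Lie derivative is a Lie algebra action on smooth functions** (general linear real group
`H`, `A` finite-dimensional): `[X, Y] φ = X (Y φ) - Y (X φ)` for `φ` smooth in the archimedean
variable and `X, Y ∈ 𝔤`. With `F(M) = φ (g ι(exp (log M)))` near `M = 1` (`log` the local
logarithm; `F (exp sX exp tZ) = φ (g ι(exp sX) ι(exp tZ))` for small `s, t` because
`log (exp sX exp tZ) ∈ 𝔤`, `eventually_log_exp_neg_mul_exp_mul_exp_mem`), one has
`(Z φ)(g ι(exp sX)) = DF(exp sX)(exp(sX) Z)` and `(X (Y φ))(g) = D²F(1)(X, Y) + DF(1)(XY)`; the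
symmetric second derivative cancels in the antisymmetrisation.
Borel–Jacquet 1979, §1.5; Goldfeld 2006, Prop. 2.2.3 (`D_α D_β - D_β D_α = D_{[α,β]}` on
`GL_n(ℝ)`, same proof); Knapp 2002, I.§10, Prop. 1.89. [cite: Goldfeld2006, Prop. 2.2.3] -/
theorem lieDeriv_bracket [FiniteDimensional ℝ A] (X Y : H.lie) {φ : G → ℂ}
    (hφ : IsArchSmooth ι φ) :
    lieDeriv ι ⁅X, Y⁆ φ = lieDeriv ι X (lieDeriv ι Y φ) - lieDeriv ι Y (lieDeriv ι X φ) := by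
  classical
  -- Mathlib idiom (Mathlib/Algebra/Lie/OfAssociative.lean): the commutator Lie ring on matrices
  letI : LieRing (Matrix N N A) := LieRing.ofAssociativeRing
  obtain ⟨π, hπ⟩ := H.exists_retraction_lie
  have hπmem : ∀ M : Matrix N N A, M ∈ H.lie → ((π M : H.lie.toSubmodule) : Matrix N N A) = M :=
    fun M hM => by rw [hπ ⟨M, hM⟩]
  let E : Matrix N N A → H.carrier := fun M => H.expMem ⟨π M, (π M).2⟩
  have hπc : ContDiff ℝ ∞ (π : Matrix N N A → H.lie.toSubmodule) :=
    (⟨π, π.continuous_of_finiteDimensional⟩ : Matrix N N A →L[ℝ] H.lie.toSubmodule).contDiff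
  have hΦ : ∀ g' : G, ContDiff ℝ ∞ fun M : Matrix N N A => φ (g' * ι (E M)) := fun g' =>
    (hφ g').comp hπc
  have hlog : ContDiffAt ℝ ∞ (localLog : Matrix N N A → Matrix N N A) 1 := contDiffAt_localLog
  have hright : ∀ᶠ y in 𝓝 (1 : Matrix N N A), NormedSpace.exp (localLog y) = y :=
    eventually_exp_localLog
  have hexp0 : H.expMem (0 : H.lie) = 1 := Subtype.ext (by simp)
  funext g
  -- `F(M) = φ (g ι(E (log M)))`, smooth near `1`
  set F : Matrix N N A → ℂ := fun M => φ (g * ι (E (localLog M))) with hF_def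
  have hF1 : ContDiffAt ℝ ∞ F 1 := (hΦ g).contDiffAt.comp 1 hlog
  have h2top : (2 : WithTop ℕ∞) ≤ ∞ := ENat.natCast_le_of_coe_top_le_withTop le_rfl 2
  have hF2 : ∀ᶠ M in 𝓝 (1 : Matrix N N A), ContDiffAt ℝ 2 F M :=
    (hF1.of_le h2top).eventually (by simp)
  -- the chart: `F (exp sX' exp tZ) = φ (g ι(exp sX') ι(exp tZ))` for small `s, t`
  have hchart : ∀ X' Z : H.lie, ∀ᶠ s in 𝓝 (0 : ℝ), ∀ᶠ t in 𝓝 (0 : ℝ),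
      F (NormedSpace.exp (s • (X' : Matrix N N A)) * NormedSpace.exp (t • (Z : Matrix N N A))) =
        φ (g * ι (H.expMem (s • X')) * ι (H.expMem (t • Z))) := by
    intro X' Z
    set Pr : ℝ × ℝ → Matrix N N A := fun q =>
      NormedSpace.exp (q.1 • (X' : Matrix N N A)) * NormedSpace.exp (q.2 • (Z : Matrix N N A))
      with hPr
    have hPrc : Continuous Pr :=
      (NormedSpace.exp_continuous.comp (continuous_fst.smul continuous_const)).mul
        (NormedSpace.exp_continuous.comp (continuous_snd.smul continuous_const))
    have hPr0 : Pr (0, 0) = 1 := by simp [hPr]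
    -- membership `log (exp sX' exp tZ) ∈ 𝔤` (chart lemma at `Y₀ = 0`)
    have hθ : Continuous (fun q : ℝ × ℝ => (q.1 • (X' : Matrix N N A), q.2)) :=
      (continuous_fst.smul continuous_const).prodMk continuous_snd
    have h1 : ∀ᶠ q : ℝ × ℝ in 𝓝 (0, 0), localLog (Pr q) ∈ H.lie.toSubmodule := by
      have hK := H.eventually_localLog_mem_lie H.lie.toSubmodule.zero_mem Z.2
      have := (hθ.tendsto ((0 : ℝ), (0 : ℝ))).eventually
        (show ∀ᶠ p in 𝓝 ((fun q : ℝ × ℝ => (q.1 • (X' : Matrix N N A), q.2)) (0, 0)),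
          p.1 ∈ H.lie.toSubmodule → localLog (NormedSpace.exp (-0) * NormedSpace.exp p.1 *
            NormedSpace.exp (p.2 • (Z : Matrix N N A))) ∈ H.lie.toSubmodule by
          simpa only [zero_smul] using hK)
      filter_upwards [this] with q hq
      have := hq (H.lie.toSubmodule.smul_mem q.1 X'.2)
      simpa only [neg_zero, NormedSpace.exp_zero, one_mul, hPr] using this
    have h2 : ∀ᶠ q : ℝ × ℝ in 𝓝 (0, 0), NormedSpace.exp (localLog (Pr q)) = Pr q :=
      (hPrc.tendsto ((0 : ℝ), (0 : ℝ))).eventually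
        (show ∀ᶠ y in 𝓝 (Pr (0, 0)), NormedSpace.exp (localLog y) = y by rw [hPr0]; exact hright)
    have h12 : ∀ᶠ q : ℝ × ℝ in 𝓝 ((0 : ℝ), (0 : ℝ)),
        F (Pr q) = φ (g * ι (H.expMem (q.1 • X')) * ι (H.expMem (q.2 • Z))) := by
      filter_upwards [h1, h2] with q hq1 hq2
      have key : E (localLog (Pr q)) = H.expMem (q.1 • X') * H.expMem (q.2 • Z) := by
        refine Subtype.ext (Units.ext ?_)
        change NormedSpace.exp ((π (localLog (Pr q)) : H.lie.toSubmodule) : Matrix N N A) =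
          NormedSpace.exp (((q.1 • X' : H.lie)) : Matrix N N A) *
            NormedSpace.exp (((q.2 • Z : H.lie)) : Matrix N N A)
        rw [hπmem _ hq1, hq2]
        rfl
      simp only [hF_def]
      rw [key, map_mul, mul_assoc]
    rw [nhds_prod_eq] at h12
    exact h12.curry
  -- first derivatives: `(Z φ)(g ι(exp sX')) = DF(exp sX')(exp(sX') Z)` for small `s`
  have hD1 : ∀ X' Z : H.lie, ∀ᶠ s in 𝓝 (0 : ℝ),
      lieDeriv ι Z φ (g * ι (H.expMem (s • X'))) =
        fderiv ℝ F (NormedSpace.exp (s • (X' : Matrix N N A)))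
          (NormedSpace.exp (s • (X' : Matrix N N A)) * (Z : Matrix N N A)) := by
    intro X' Z
    have hes : ∀ᶠ s in 𝓝 (0 : ℝ), ContDiffAt ℝ 2 F (NormedSpace.exp (s • (X' : Matrix N N A))) := by
      have hc : Continuous fun s : ℝ => NormedSpace.exp (s • (X' : Matrix N N A)) :=
        NormedSpace.exp_continuous.comp (continuous_id.smul continuous_const)
      exact (hc.tendsto 0).eventually (show ∀ᶠ M in 𝓝 (NormedSpace.exp ((0 : ℝ) •
        (X' : Matrix N N A))), ContDiffAt ℝ 2 F M by simpa using hF2)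
    filter_upwards [hes, hchart X' Z] with s hs hst
    have hγ : HasDerivAt (fun t : ℝ => NormedSpace.exp (s • (X' : Matrix N N A)) *
        NormedSpace.exp (t • (Z : Matrix N N A)))
        (NormedSpace.exp (s • (X' : Matrix N N A)) * (Z : Matrix N N A)) 0 := by
      have := (hasDerivAt_exp_smul_const' (𝕂 := ℝ) (Z : Matrix N N A) (0 : ℝ)).const_mul
        (NormedSpace.exp (s • (X' : Matrix N N A)))
      simpa using this
    have hcomp : HasDerivAt (fun t : ℝ => F (NormedSpace.exp (s • (X' : Matrix N N A)) *
        NormedSpace.exp (t • (Z : Matrix N N A))))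
        (fderiv ℝ F (NormedSpace.exp (s • (X' : Matrix N N A)))
          (NormedSpace.exp (s • (X' : Matrix N N A)) * (Z : Matrix N N A))) 0 := by
      have hFd : DifferentiableAt ℝ F (NormedSpace.exp (s • (X' : Matrix N N A)) *
          NormedSpace.exp ((0 : ℝ) • (Z : Matrix N N A))) := by
        rw [zero_smul, NormedSpace.exp_zero, mul_one]
        exact hs.differentiableAt (by simp)
      have := hFd.hasFDerivAt.comp_hasDerivAt (0 : ℝ) hγ
      rwa [zero_smul, NormedSpace.exp_zero, mul_one] at this
    change deriv (fun t : ℝ => φ (g * ι (H.expMem (s • X')) * ι (H.expMem (t • Z)))) 0 = _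
    rw [← hcomp.deriv]
    exact Filter.EventuallyEq.deriv_eq (hst.mono fun t ht => ht.symm)
  -- second derivatives: `(X' (Y' φ))(g) = D²F(1)(X', Y') + DF(1)(X' Y')`
  have hD2 : ∀ X' Y' : H.lie, lieDeriv ι X' (lieDeriv ι Y' φ) g =
      fderiv ℝ (fderiv ℝ F) 1 (X' : Matrix N N A) (Y' : Matrix N N A) +
        fderiv ℝ F 1 ((X' : Matrix N N A) * (Y' : Matrix N N A)) := by
    intro X' Y'
    have hγ : HasDerivAt (fun s : ℝ => NormedSpace.exp (s • (X' : Matrix N N A)))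
        (X' : Matrix N N A) 0 := by
      simpa using hasDerivAt_exp_smul_const' (𝕂 := ℝ) (X' : Matrix N N A) (0 : ℝ)
    have hF2' : HasFDerivAt (fderiv ℝ F) (fderiv ℝ (fderiv ℝ F) 1) (1 : Matrix N N A) := by
      have h := hF1.fderiv_right (m := 1) (WithTop.coe_le_coe.2 le_top)
      exact (h.differentiableAt (by simp)).hasFDerivAt
    have hc : HasDerivAt (fun s : ℝ => fderiv ℝ F (NormedSpace.exp (s • (X' : Matrix N N A))))
        (fderiv ℝ (fderiv ℝ F) 1 (X' : Matrix N N A)) 0 := by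
      have hF2'' : HasFDerivAt (fderiv ℝ F) (fderiv ℝ (fderiv ℝ F) 1)
          (NormedSpace.exp ((0 : ℝ) • (X' : Matrix N N A))) := by
        rwa [zero_smul, NormedSpace.exp_zero]
      exact HasFDerivAt.comp_hasDerivAt (l := fderiv ℝ F)
        (f := fun s : ℝ => NormedSpace.exp (s • (X' : Matrix N N A))) (0 : ℝ) hF2'' hγ
    have hu : HasDerivAt (fun s : ℝ => NormedSpace.exp (s • (X' : Matrix N N A)) * (Y' : Matrix N N A))
        ((X' : Matrix N N A) * (Y' : Matrix N N A)) 0 := hγ.mul_const _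
    have hboth := hc.clm_apply hu
    simp only [zero_smul, NormedSpace.exp_zero, one_mul] at hboth
    change deriv (fun s : ℝ => lieDeriv ι Y' φ (g * ι (H.expMem (s • X')))) 0 = _
    rw [Filter.EventuallyEq.deriv_eq (hD1 X' Y'), hboth.deriv]
  -- the value of `[X, Y] φ` at `g`
  have hXY : lieDeriv ι ⁅X, Y⁆ φ g =
      fderiv ℝ F 1 ((X : Matrix N N A) * (Y : Matrix N N A)) -
        fderiv ℝ F 1 ((Y : Matrix N N A) * (X : Matrix N N A)) := by
    have h := (hD1 X ⁅X, Y⁆).self_of_nhds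
    simp only [zero_smul, hexp0, map_one, mul_one, NormedSpace.exp_zero, one_mul] at h
    rw [LieSubalgebra.coe_bracket, Ring.lie_def, map_sub] at h
    exact h
  -- symmetry of the second derivative
  have hsymm : IsSymmSndFDerivAt ℝ F (1 : Matrix N N A) :=
    hF1.isSymmSndFDerivAt (n := ∞) (by simpa using h2top)
  rw [Pi.sub_apply, hD2 X Y, hD2 Y X, hXY, hsymm (X : Matrix N N A) (Y : Matrix N N A)]
  abel

/-! ### The Lie algebra representation on smooth functions and the action of `U(𝔤)` -/

variable [FiniteDimensional ℝ A]

/-- **The representation of `𝔤` on archimedean-smooth functions by Lie derivatives exists for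
every linear real group `H`** (finite-dimensional coefficients): there is a morphism of real Lie
algebras `ρ : 𝔤 →ₗ⁅ℝ⁆ End_ℂ (archSmooth ι)` with `ρ X ψ = X ψ` (`X ψ` is smooth by
`isArchSmooth_lieDeriv_of_isArchSmooth`, `ℂ`-linear in `ψ`, `ℝ`-linear in `X`, and
`[X, Y] ↦ X Y - Y X` by `lieDeriv_bracket`); cf. the definition `lieDerivRep` of
`ArchimedeanEnvelopingAction` for `H.lie = ⊤ = H.carrier`.
Borel–Jacquet 1979, §1.5; Knapp 2002, I.§10, Prop. 1.89 and III.§1. [cite: BorelJacquet1979, §1.5] -/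
theorem exists_lieHom_lieDeriv :
    ∃ ρ : H.lie →ₗ⁅ℝ⁆ Module.End ℂ (archSmooth ι),
      ∀ (X : H.lie) (ψ : archSmooth ι), ((ρ X ψ : archSmooth ι) : G → ℂ) = lieDeriv ι X ψ := by
  -- `X ↦ (ψ ↦ X ψ)` as a family of `ℂ`-linear endomorphisms of `archSmooth ι`
  let T : H.lie → Module.End ℂ (archSmooth ι) := fun X =>
    { toFun := fun ψ => ⟨lieDeriv ι X ψ, (mem_archSmooth_iff ι _).2
        (isArchSmooth_lieDeriv_of_isArchSmooth ι X ((mem_archSmooth_iff ι _).1 ψ.2))⟩,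
      map_add' := fun ψ₁ ψ₂ => Subtype.ext (IsArchSmooth.lieDeriv_add ι X
        ((mem_archSmooth_iff ι _).1 ψ₁.2) ((mem_archSmooth_iff ι _).1 ψ₂.2)),
      map_smul' := fun c ψ => Subtype.ext (lieDeriv_smul X c (ψ : G → ℂ)) }
  have hT : ∀ (X : H.lie) (ψ : archSmooth ι), ((T X ψ : archSmooth ι) : G → ℂ) = lieDeriv ι X ψ :=
    fun _ _ => rfl
  refine ⟨{ toFun := T, map_add' := ?_, map_smul' := ?_, map_lie' := ?_ }, hT⟩
  · intro X Y
    exact LinearMap.ext fun ψ =>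
      Subtype.ext (IsArchSmooth.lieDeriv_add_left ι ((mem_archSmooth_iff ι _).1 ψ.2) X Y)
  · intro a X
    refine LinearMap.ext fun ψ => Subtype.ext ?_
    change lieDeriv ι (a • X) ψ = (a : ℂ) • lieDeriv ι X ψ
    rw [IsArchSmooth.lieDeriv_smul_left ι ((mem_archSmooth_iff ι _).1 ψ.2),
      real_smul_fun_eq_coe_smul]
  · intro X Y
    refine LinearMap.ext fun ψ => Subtype.ext ?_
    change lieDeriv ι ⁅X, Y⁆ ψ = lieDeriv ι X (lieDeriv ι Y ψ) - lieDeriv ι Y (lieDeriv ι X ψ)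
    exact lieDeriv_bracket ι X Y ((mem_archSmooth_iff ι _).1 ψ.2)

variable {ι}

omit [FiniteDimensional ℝ A] in
/-- **The word action factors through `U(𝔤)` on smooth functions** (every linear real group
`H`): if `ρ : 𝔤 →ₗ⁅ℝ⁆ End_ℂ (archSmooth ι)` acts by Lie derivatives, then for `p ∈ ℝ⟨𝔤⟩` and
smooth `ψ`, `p ψ` (`applyFree ι p ψ`, defined on words) is the action of the image of `p` in
`U(𝔤)` under `envelopingAction ρ` (both sides are `ℝ`-linear in `p` and agree on the word basis).
Borel–Jacquet 1979, §1.5–1.6; Dixmier, *Enveloping Algebras*, 2.1.1. [cite: BorelJacquet1979, §1.6] -/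
theorem coe_envelopingAction_freeToEnveloping_of_forall_eq (ρ : H.lie →ₗ⁅ℝ⁆ Module.End ℂ (archSmooth ι))
    (hρ : ∀ (X : H.lie) (ψ : archSmooth ι), ((ρ X ψ : archSmooth ι) : G → ℂ) = lieDeriv ι X ψ)
    (p : FreeAlgebra ℝ H.lie) (ψ : archSmooth ι) :
    ((envelopingAction ρ (freeToEnveloping H p) ψ : archSmooth ι) : G → ℂ) = applyFree ι p ψ := by
  -- on a product of generators, `U(𝔤)` acts by the iterated Lie derivative
  have hprod : ∀ l : List H.lie,
      (((l.map ρ).prod ψ : archSmooth ι) : G → ℂ) = iterLieDeriv ι l ψ := by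
    intro l
    induction l with
    | nil => simp
    | cons X l ih =>
      rw [List.map_cons, List.prod_cons, Module.End.mul_apply, hρ, ih, iterLieDeriv_cons]
  set Aρ : FreeAlgebra ℝ H.lie →ₐ[ℝ] Module.End ℂ (archSmooth ι) :=
    (envelopingAction ρ).comp (freeToEnveloping H) with hAρ
  let R : FreeAlgebra ℝ H.lie →ₗ[ℝ] (G → ℂ) :=
    { toFun := fun q => ((Aρ q ψ : archSmooth ι) : G → ℂ)
      map_add' := fun q₁ q₂ => by rw [map_add, LinearMap.add_apply, Submodule.coe_add]
      map_smul' := fun a q => by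
        rw [map_smul, LinearMap.smul_apply, RingHom.id_apply, real_smul_fun_eq_coe_smul]
        rfl }
  let L : FreeAlgebra ℝ H.lie →ₗ[ℝ] (G → ℂ) :=
    { toFun := fun q => applyFree ι q ψ
      map_add' := fun q₁ q₂ => applyFree_add ι q₁ q₂ _
      map_smul' := fun c q => by rw [applyFree_smul_left, RingHom.id_apply, real_smul_fun_eq_coe_smul] }
  suffices hRL : R = L from LinearMap.congr_fun hRL p
  refine (FreeAlgebra.basisFreeMonoid ℝ H.lie).ext fun w => ?_
  change ((Aρ (FreeAlgebra.basisFreeMonoid ℝ H.lie w) ψ : archSmooth ι) : G → ℂ) =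
    applyFree ι (FreeAlgebra.basisFreeMonoid ℝ H.lie w) ψ
  rw [applyFree_basisFreeMonoid, basisFreeMonoid_eq_lift, ← FreeMonoid.ofList_toList w,
    FreeMonoid.lift_apply, FreeMonoid.toList_ofList, hAρ, map_list_prod, List.map_map]
  have hcomp : ((envelopingAction ρ).comp (freeToEnveloping H) : _ → _) ∘ FreeAlgebra.ι ℝ =
      (ρ : H.lie → Module.End ℂ (archSmooth ι)) := by
    funext X
    change envelopingAction ρ (freeToEnveloping H (FreeAlgebra.ι ℝ X)) = _
    rw [freeToEnveloping_ι, envelopingAction_ι]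
  rw [hcomp]
  exact hprod _

omit [FiniteDimensional ℝ A] in
/-- **Discharge of the named fact `applyFree_congr`** of `ArchimedeanCalculus`, for every linear
real group `H` and every homomorphism `ι : H → G` (finite-dimensional coefficient algebra): on
functions smooth in the archimedean variable the word action of `ℝ⟨𝔤⟩` factors through `U(𝔤)` —
if `p, q ∈ ℝ⟨𝔤⟩` have the same image in `U(𝔤)` then `p φ = q φ`. Borel–Jacquet 1979, §1.5
(`U(𝔤)` acts on smooth functions by right-invariant differential operators); Dixmier,
*Enveloping Algebras*, 2.1.1. [cite: BorelJacquet1979, §1.5] -/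
theorem applyFree_congr_holds : applyFree_congr (ι := ι) := by
  intro _ p q hpq φ hφ
  obtain ⟨ρ, hρ⟩ := exists_lieHom_lieDeriv ι
  rw [← coe_envelopingAction_freeToEnveloping_of_forall_eq ρ hρ p ⟨φ, hφ⟩,
    ← coe_envelopingAction_freeToEnveloping_of_forall_eq ρ hρ q ⟨φ, hφ⟩, hpq]

/-- `p φ` is smooth for smooth `φ` and every `p ∈ ℝ⟨𝔤⟩` (every linear real group `H`).
Borel–Jacquet 1979, §1.5. [cite: BorelJacquet1979, §1.5] -/
theorem isArchSmooth_applyFree_of_isArchSmooth (p : FreeAlgebra ℝ H.lie) {φ : G → ℂ}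
    (hφ : IsArchSmooth ι φ) : IsArchSmooth ι (applyFree ι p φ) := by
  obtain ⟨ρ, hρ⟩ := exists_lieHom_lieDeriv ι
  rw [← coe_envelopingAction_freeToEnveloping_of_forall_eq ρ hρ p ⟨φ, hφ⟩]
  exact (mem_archSmooth_iff ι _).1 (Subtype.coe_prop _)

/-- **`(X · p) φ = X (p φ)`** on smooth `φ` (every linear real group `H`).
Borel–Jacquet 1979, §1.5–1.6. [cite: BorelJacquet1979, §1.6] -/
theorem applyFree_ι_mul_of_isArchSmooth (X : H.lie) (p : FreeAlgebra ℝ H.lie) {φ : G → ℂ}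
    (hφ : IsArchSmooth ι φ) :
    applyFree ι (FreeAlgebra.ι ℝ X * p) φ = lieDeriv ι X (applyFree ι p φ) := by
  obtain ⟨ρ, hρ⟩ := exists_lieHom_lieDeriv ι
  rw [← coe_envelopingAction_freeToEnveloping_of_forall_eq ρ hρ _ ⟨φ, hφ⟩,
    ← coe_envelopingAction_freeToEnveloping_of_forall_eq ρ hρ p ⟨φ, hφ⟩, map_mul, map_mul,
    Module.End.mul_apply, freeToEnveloping_ι, envelopingAction_ι, hρ]

/-- **Central elements commute with Lie derivatives** on smooth functions (every linear real
group `H`): for a central word `z` and smooth `φ`, `z (X φ) = X (z φ)`.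
Borel–Jacquet 1979, §1.6 and 4.3 (ii). [cite: BorelJacquet1979, 4.3 (ii)] -/
theorem applyFree_lieDeriv_of_isCentralWord_of_isArchSmooth {p : FreeAlgebra ℝ H.lie}
    (hp : IsCentralWord p) (X : H.lie) {φ : G → ℂ} (hφ : IsArchSmooth ι φ) :
    applyFree ι p (lieDeriv ι X φ) = lieDeriv ι X (applyFree ι p φ) := by
  rw [← applyFree_mul_ι, ← applyFree_ι_mul_of_isArchSmooth X p hφ]
  refine applyFree_congr_holds (ι := ι) ?_ hφ
  rw [map_mul, map_mul, freeToEnveloping_ι]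
  exact ((Subalgebra.mem_center_iff.1 hp) _).symm

end General

end Literature.NumberTheory.Automorphic
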